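import Literature.MathematicalPhysics.QuantumFieldTheory.Balaban1983to89.B12CondIIIJConcrete
import Literature.MathematicalPhysics.QuantumFieldTheory.Balaban1983to89.B12Lemma4Chain

/-!
# `Balaban1983to89.B12Lemma4Assembled` — T. Bałaban, *Renormalization group approach to lattice gauge field theories. I*,
Commun. Math. Phys. **109** (1987) 249–301 [Balaban1987RG1], §3 pp. 277–280: **Lemma 4 (3.53) on the concrete space `B12RegularSpaces111`,
THE WHOLE PRINTED MECHANISM ASSEMBLED** — from the membership of `𝐔` in the upper space `U′ᶜ_{k+1}(□₀, (1+2β)α₀, ·)` ((3.40)), the three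
printed identities (3.38), (3.39)(+(3.37)) and (3.42) with their gauge transformations of bounded cost, and the [15]-bounds on `𝐇_j`, `H_{1,j}`,
`𝐀₂`, to `(U_j(□₀, exp i(τB + B′)), J_j(□₀, exp i(τB + B′)))|_X ∈ U^c_j(X, α₀, α₁)` with conditions (i), (ii), BOTH halves of (iii) and (iv)
DERIVED — the first half of (iii) via (3.41)–(3.52) (`B12Lemma4Concrete`, `B12Ineq341Rotation.h41_of_eq339`), the J-half via (3.42) and
[14] (1.43)–(1.54) (`B12CondIIIJConcrete`, `B12Ineq341Rotation.h42_of_eq342`), (iv) via (3.38) (`B12Eq338CondIV` / `B12Lemma4CondIV`),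
(3.40) read off the upper space (`B12Lemma4Chain.ineq340_of_satisfies`).

HONEST FRAMING (cell `lit-balaban`, verbatim): statement-level skeleton of published theorems with citation tags; proofs where landed; nothing here is a claim about the Yang–Mills mass gap.

PDF held: `paper:balaban1987-cmp109-rg-i-small-field` (journal page = PDF page + 248); pp. 277–280 re-read as images from the renders
`b2b-balaban-ref1/pages/1987-cmp109-rg-I-small-field/1987-cmp109-rg-I-small-field-p029…p032-x4.png` by this unit (p07 gens 6–8).
THE PRINT, verbatim (p. 280): *«Lemma 4. For 𝐔 ∈ U′ᶜ_{k+1}(□₀, (1+2β)α₀, (1+2β)α₁), 𝐀 defined on □₀ and satisfying (3.31), B′ defined on the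
set of bonds connected with the definition of U_j(□₀, ·) and satisfying |B′| < α₃, we have (U_j(□₀, exp i(τB + B′)), J_j(□₀, exp i(τB +
B′)))|_X ∈ U^c_j(X, α₀, α₁) (3.53) for α₀, α₁, α₂, α₃ sufficiently small and satisfying all the restrictions.»*; p. 278: *«The assumption that
the configuration 𝐔 belongs to the space U′ᶜ_{k+1}(□₀, (1+2β)α₀, (1+β)α₁, α₀) implies in particular the inequalities (3.40) … Using
(3.37)–(3.40) we get [(3.41)] … A similar inequality holds for the expression replacing the variable 𝐉 [(3.42)] … This identity [(3.38)] and
the bound on u_j in (3.37) imply that the condition (iv) is a consequence of the condition (iii)»*.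

WHAT THIS MODULE PROVES (v1: one theorem; v1.1: + the `B′ = 0` case (3.36) and the non-vacuity of the restriction list; no `def`, no new
`Prop`, no new fact; axioms standard):
**`ofBackground_mem_space'_lemma4_of_upper_space`** = `B12CondIIIJConcrete.ofBackground_mem_space'_lemma4_of_jInputs` (p07 gen 8) with
its two remaining displayed inputs DISCHARGED from their printed sources: `h41` (the literal first inequality of (3.41)) from the identity
(3.39)+(3.37) `h339` + (3.40) + the four rotation costs (`B12Ineq341Rotation.h41_of_eq339`, `B12Lemma4Chain.ineq340_first_on`), and
`h42` (the bound (3.42)) from the identity (3.42) `h342` + the J-part of (3.40) + the same costs (`B12Ineq341Rotation.h42_of_eq342`,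
`B12Lemma4Chain.ineq340_of_satisfies`); (3.40) itself from the membership datum `Φ = (𝐔, 𝐉′) ∈ U′ᶜ_{k+1}` of the frame `F′` of `□₀`.
WHAT REMAINS BY REFERENCE (hypotheses, each in its printed shape): the functions `𝐇_j(□₀, Q)`, `𝐇_j(□₀, τQ)`, `H_{1,j}Q`, `𝐀₂`, `U_n(M˙(·))`,
`J_n`, the gauge transformations `u_j, ū_j, v_j, v, ū_{k+1}` of [14, 15] with the cost bounds of (3.26)/(3.37); the identities (3.38), (3.39),
(3.42) as equalities of plaquette variables / currents (`h338`, `hJn`, `h338₁`, `hJn₁`, `h339`, `h342`); the sizes (3.37), (3.45)×2, (3.50),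
the second-order inputs (J2)×2, (J3); «all the restrictions» + `B₃ ≥ 1`, `B₃²O(1)M ≥ 1`, `16·O(1)Mα₁ ≤ β`, `1 + 10β ≤ L²` (⇐ `L ≥ 4`,
`B12CondIIIJConcrete.hL10_of_four_le`), `B₃″α₃ ≤ βL⁻²α₀`, `4·C_J·B²·α₀ ≤ β`; analyticity is `B12CondIIIJConcreteModels.analyticAt_pair_lemma4`.
Unit `lit-balaban-p07` (Phase-2 seat p07 gen 8; TAKING line HOME/STATUS.md 2026-08-21T18:46:03Z; rows B12.Lem4 / B12.Eq3.36 /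
B12.Eq3.37-3.47, owners r09/r20), HOME `run/shared/lean/pub/lit-balaban/`.
-/

noncomputable section

open NormedSpace Complex

namespace Literature.MathematicalPhysics.QuantumFieldTheory.Balaban1983to89.B12Lemma4Assembled

open Literature.MathematicalPhysics.QuantumFieldTheory.Balaban1983to89
open Literature.MathematicalPhysics.QuantumFieldTheory.Balaban1983to89.B9Eq39Adjoint (R)
open Literature.MathematicalPhysics.QuantumFieldTheory.Balaban1983to89.B12Eq311CurrentExpansion
open Literature.MathematicalPhysics.QuantumFieldTheory.Balaban1983to89.B12RegularSpaces111
open Literature.MathematicalPhysics.QuantumFieldTheory.Balaban1983to89.B12Eq18Current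
open Literature.MathematicalPhysics.QuantumFieldTheory.Balaban1983to89.B12CondIIIJConcrete

variable {P : Params} {i : ℕ} {𝔸 : Type*} [NormedRing 𝔸] [NormedAlgebra ℂ 𝔸] [CompleteSpace 𝔸] [NormOneClass 𝔸]
variable (𝓜 : Model 𝔸)

/-- **Lemma 4 (3.53) on the concrete space — the printed mechanism assembled end to end.**  Data: the frame `F` of `X` at scale `j` with its
(3.38)-functions `F.bg`, the frame `F′` of `□₀` at scale `k+1` (`cs′.j = k+1 ≥ 1`, `L^{k+1}ξ′ = 1`, `ξ′ = L⁻¹η`) and a pair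
`Φ = (𝐔, 𝐉′) ∈ U′ᶜ_{k+1}(□₀, (1+2β)α₀, a₁, γ₀′)` («𝐔 ∈ U′ᶜ_{k+1}(□₀, (1+2β)α₀, (1+2β)α₁)»); `𝐇 = 𝐇_j(□₀, Q(L⁻¹η𝐇_{k+1}))`,
`𝐊 = 𝐇_j(□₀, τQ(…))`, their common linear part `H₁ = H_{1,j}Q(…)`, `𝐀 = 𝐀₂(B′)` with `|B′| = n < α₃`; the identities (3.39)+(3.37)
(`h339`: plaquettes of `exp iξ𝐇` on `X` = those of `U_{k+1}(□₀, M˙(𝐔))^{(vū_{k+1}v_ju_j)⁻¹}`), (3.42) (`h342`: the current of `exp iξ𝐇` on the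
bonds of `Y` = □̃³ is `R((vū_{k+1}v_ju_j)⁻¹)((L^{j−1}η)³J_{k+1}(□₀, M˙(𝐔)))`), (3.38) for `V = exp iξ(𝐊 + 𝐀)` and for `1` (`h338`, `hJn`,
`h338₁`, `hJn₁`), all gauge transformations with the printed costs.  Conclusion: the printed pair `(V, J(V))`, `J` = the current (1.8)
with projection `π`, lies in `U^c_j(X, α₀, α₁)` — (i), (ii), both halves of (iii), (iv) derived.
[cite: Balaban1987RG1, Lemma 4 (3.53) p.280 with (3.37)–(3.52) pp.277–280] -/
theorem ofBackground_mem_space'_lemma4_of_upper_space (c : B12Sec2to5.Lemma4Consts) (hR : B12Sec2to5.Lemma4Restrictions c)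
    (hB : 1 ≤ c.B₃) (hY : 1 ≤ c.B₃ ^ 2 * c.O₁ * c.M) (hα₁ : 16 * (c.O₁ * c.M * c.α₁) ≤ c.β) (hL10 : 1 + 10 * c.β ≤ c.L ^ 2)
    {F : Frame P i 𝔸} {cs : StepConsts} (hξ : 0 < cs.ξ) (hξ1 : cs.ξ ≤ 1) (hcB : 0 < cs.cB)
    (hL : 1 ≤ cs.L) (hLξ : cs.L ^ cs.j * cs.ξ = 1)
    {η τ n B₃'' Cπ : ℝ} {j : ℕ} (hη : 0 < η) (hj : 1 ≤ j) (hscale : c.L ^ j * η ≤ 1)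
    (hξx : cs.ξ * (c.L ^ (j - 1) * η) = c.L⁻¹ * η) (hτ0 : 0 ≤ τ) (hτ1 : τ ≤ 1) (hn : n < c.α₃) (hB'' : 0 ≤ B₃'')
    (hres'' : B₃'' * c.α₃ ≤ c.β * c.L⁻¹ ^ 2 * c.α₀)
    (hresJ : 4 * ((P.d - 1) * (Cπ * C311 1)) * (c.B₃ ^ 2 * c.O₁ * c.M) ^ 2 * c.α₀ ≤ c.β)
    (heGc : ∀ A ∈ 𝓜.gc, expI cs.ξ A ∈ 𝓜.Gc) (π : 𝔸 →ₗ[ℂ] 𝔸) (hπ : ∀ X, π X ∈ 𝓜.gc)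
    (hgc : ∀ g ∈ 𝓜.Gc, ∀ X ∈ 𝓜.gc, R g X ∈ 𝓜.gc) (hπR : ∀ (g : 𝔸ˣ) (X : 𝔸), π (R g X) = R g (π X))
    (hCπ : 0 ≤ Cπ) (hπn : ∀ X, ‖π X‖ ≤ Cπ * ‖X‖)
    -- the upper space: the frame `F′` of `□₀` at scale `k+1` and the membership datum `Φ` ((3.40))
    {F' : Frame P i 𝔸} {cs' : StepConsts} (hj' : 1 ≤ cs'.j) (hLξ' : cs'.L ^ cs'.j * cs'.ξ = 1) (hξ' : cs'.ξ = c.L⁻¹ * η)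
    {a₁ γ₀' : ℝ} {Φ : FieldPair P i 𝔸ˣ 𝔸} (hΦ : Satisfies 𝓜 F' cs' ((1 + 2 * c.β) * c.α₀) a₁ γ₀' Φ)
    -- geometry: `Y` = □̃³ ⊇ bonds of `X` and of `X̃⁻²(F)`; `X ⊆ X̃⁻²(F′)`, `Y ⊆ X̃⁻²(F′)` (bonds)
    {Y : Region P i} (hXb : F.X.bonds ⊆ Y.bonds) (hXd : F.X.dpairs ⊆ Y.dpairs) (hX₂b : F.X₂.bonds ⊆ Y.bonds)
    (hX₂p : F.X₂.plaqs ⊆ F.X.plaqs) (hXp' : F.X.plaqs ⊆ F'.X₂.plaqs) (hYb' : Y.bonds ⊆ F'.X₂.bonds)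
    (hXp : ∀ p ∈ F.X.plaqs, (⟨p.src, p.μ⟩ : PBond P i) ∈ Y.bonds ∧ (⟨p.src.shift p.μ, p.ν⟩ : PBond P i) ∈ Y.bonds ∧
      (⟨p.src.shift p.ν, p.μ⟩ : PBond P i) ∈ Y.bonds ∧ (⟨p.src, p.ν⟩ : PBond P i) ∈ Y.bonds ∧
      (p.src, p.μ, p.ν) ∈ Y.dpairs ∧ (p.src, p.ν, p.μ) ∈ Y.dpairs)
    {H H₁ K A : PBond P i → 𝔸} {ℓ : Plaq P i → 𝔸} (hKgc : ∀ b, K b ∈ 𝓜.gc) (hAgc : ∀ b, A b ∈ 𝓜.gc)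
    -- the gauge transformations of (3.37)/(3.39)/(3.42) (`u_j`, `ū_{k+1}`, `v_j`, `v`) and of (3.38) (`ū_j = u_j ∘ ctr`, `w₁`), with costs
    {uj ubar1 vj v : Site P i → 𝔸ˣ} {ubar w₁ : ℕ → Site P i → 𝔸ˣ} {ctr : ℕ → Site P i → Site P i}
    (huj : ∀ y, ‖(uj y : 𝔸)‖ * ‖(↑(uj y)⁻¹ : 𝔸)‖ ≤ Real.exp (c.B₃ ^ 2 * c.O₁ * c.M * c.α₀))
    (hubar1 : ∀ y, ‖(ubar1 y : 𝔸)‖ * ‖(↑(ubar1 y)⁻¹ : 𝔸)‖ ≤ Real.exp (c.B₃ * c.O₁ * c.M * c.α₀))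
    (hvj : ∀ y, ‖(vj y : 𝔸)‖ * ‖(↑(vj y)⁻¹ : 𝔸)‖ ≤ Real.exp (c.B₃ * c.O₁ * c.M * c.α₀))
    (hv : ∀ y, ‖(v y : 𝔸)‖ * ‖(↑(v y)⁻¹ : 𝔸)‖ ≤ Real.exp (c.O₁ * c.M * c.α₁))
    (hubar : ∀ n x, ubar n x = uj (ctr n x))
    -- the identities (3.39)+(3.37) and (3.42)
    (h339 : ∀ p ∈ F.X.plaqs,
      plaq (fun b => expI cs.ξ (H b)) p = plaq (gaugeU (v * ubar1 * vj * uj)⁻¹ (F'.bg.Un cs'.j Φ.U)) p)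
    (h342 : ∀ b ∈ Y.bonds, current π cs.ξ (fun b => expI cs.ξ (H b)) b =
      ((((v * ubar1 * vj * uj)⁻¹ : Site P i → 𝔸ˣ) b.src : 𝔸ˣ) : 𝔸) *
        ((((c.L ^ (j - 1) * η : ℝ) : ℂ) ^ 3) • F'.bg.Jn cs'.j Φ.U b) * ↑((((v * ubar1 * vj * uj)⁻¹ : Site P i → 𝔸ˣ) b.src)⁻¹ : 𝔸ˣ))
    -- the identities (3.38) for `V = exp iξ(𝐊 + 𝐀)` and for `1`
    (h338 : ∀ m, 1 ≤ m → m ≤ cs.j → ∀ p ∈ F.X₂.plaqs, plaq (F.bg.Un m (fun b => expI cs.ξ (K b + A b))) p =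
      plaq (gaugeU (uj * (ubar m)⁻¹) (fun b => expI cs.ξ (K b + A b))) p)
    (hJn : ∀ m, 1 ≤ m → m ≤ cs.j → ∀ b ∈ F.X₂.bonds, F.bg.Jn m (fun b => expI cs.ξ (K b + A b)) b =
      current π (cs.L ^ m)⁻¹ (gaugeU (uj * (ubar m)⁻¹) (fun b => expI cs.ξ (K b + A b))) b)
    (h338₁ : ∀ m, 1 ≤ m → m ≤ cs.j → ∀ p ∈ F.X₂.plaqs,
      plaq (F.bg.Un m (1 : PBond P i → 𝔸ˣ)) p = plaq (gaugeU (w₁ m) (1 : PBond P i → 𝔸ˣ)) p)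
    (hJn₁ : ∀ m, 1 ≤ m → m ≤ cs.j → ∀ b ∈ F.X₂.bonds,
      F.bg.Jn m (1 : PBond P i → 𝔸ˣ) b = current π (cs.L ^ m)⁻¹ (gaugeU (w₁ m) (1 : PBond P i → 𝔸ˣ)) b)
    -- the [15]-sizes: (3.37) for 𝐇 and 𝐊 (with plain gradients), (3.45) at Q and τQ, (3.50) for 𝐀₂, (J2)×2, (J3)
    (hH : ∀ b, ‖H b‖ < c.B₃ ^ 2 * c.O₁ * c.M * c.α₀ * (c.L ^ (j - 1) * η))
    (hHd : ∀ μ ν y, ‖grad cs.ξ μ (fun z => H ⟨z, ν⟩) y‖ < c.B₃ ^ 2 * c.O₁ * c.M * c.α₀ * (c.L ^ (j - 1) * η))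
    (h45 : ∀ p ∈ F.X.plaqs, ‖(cs.ξ : ℂ)⁻¹ • (H ⟨p.src, p.μ⟩ + H ⟨p.src.shift p.μ, p.ν⟩ - H ⟨p.src.shift p.ν, p.μ⟩ -
      H ⟨p.src, p.ν⟩) - ℓ p‖ < c.B₃ * (c.B₃ * c.O₁ * c.M * c.α₀ * (c.L ^ (j - 1) * η)) ^ 2)
    (hK : ∀ b, ‖K b‖ < c.B₃ ^ 2 * c.O₁ * c.M * c.α₀ * (c.L ^ (j - 1) * η))
    (hKd : ∀ μ ν y, ‖grad cs.ξ μ (fun z => K ⟨z, ν⟩) y‖ < c.B₃ ^ 2 * c.O₁ * c.M * c.α₀ * (c.L ^ (j - 1) * η))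
    (h45τ : ∀ p ∈ F.X.plaqs, ‖(cs.ξ : ℂ)⁻¹ • (K ⟨p.src, p.μ⟩ + K ⟨p.src.shift p.μ, p.ν⟩ - K ⟨p.src.shift p.ν, p.μ⟩ -
      K ⟨p.src, p.ν⟩) - (τ : ℂ) • ℓ p‖ < c.B₃ * (c.B₃ * c.O₁ * c.M * c.α₀ * (c.L ^ (j - 1) * η)) ^ 2)
    (hA : ∀ b, ‖A b‖ ≤ c.B₃ * n) (hAd : ∀ μ ν y, ‖grad cs.ξ μ (fun z => A ⟨z, ν⟩) y‖ ≤ c.B₃ * n)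
    (hS : ∀ b ∈ Y.bonds, ‖lapCur π cs.ξ (1 : PBond P i → 𝔸ˣ) (H - H₁) b‖ < c.β * c.α₀ * (c.L ^ (j - 1) * η) ^ 2)
    (hSτ : ∀ b ∈ Y.bonds,
      ‖lapCur π cs.ξ (1 : PBond P i → 𝔸ˣ) (K - (τ : ℂ) • H₁) b‖ < c.β * c.α₀ * (c.L ^ (j - 1) * η) ^ 2)
    (hA2 : ∀ b ∈ Y.bonds, ‖lapCur π cs.ξ (1 : PBond P i → 𝔸ˣ) A b‖ ≤ B₃'' * n) :
    ofBackground π cs.ξ (fun b => expI cs.ξ (K b + A b)) ∈ space' 𝓜 F cs c.α₀ c.α₁ := by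
  have hR' := hR
  unfold B12Sec2to5.Lemma4Restrictions at hR'
  obtain ⟨_, _, _, _, _, _, _, hL1, _, _, _, _, _, _⟩ := hR'
  have hLpos : 0 < c.L := by linarith
  -- (3.40), both parts, from the membership of `Φ` in the upper space
  have h340 := B12Lemma4Chain.ineq340_first_on 𝓜 hj' hLξ' hξ' hΦ hXp'
  have h340J : ∀ b ∈ (Y.bonds : Set (PBond P i)), ‖F'.bg.Jn cs'.j Φ.U b‖ < (1 + 2 * c.β) * c.α₀ :=
    fun b hb => (B12Lemma4Chain.ineq340_of_satisfies 𝓜 hj' hLξ' hΦ).2 b (hYb' hb)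
  -- (3.41), literal first inequality, from (3.39)+(3.37), (3.40) and the costs
  have h41 := B12Ineq341Rotation.h41_of_eq339 c h339 (fun p _ => huj p.src) (fun p _ => hubar1 p.src) (fun p _ => hvj p.src)
    (fun p _ => hv p.src) h340
  -- (3.42), the bound, from the identity (3.42), the J-part of (3.40) and the costs
  have hx : 0 < c.L ^ (j - 1) * η := mul_pos (pow_pos hLpos _) hη
  have h42 := B12Ineq341Rotation.h42_of_eq342 c hR hB hY hα₁ hx h342 (fun b _ => huj b.src) (fun b _ => hubar1 b.src)
    (fun b _ => hvj b.src) (fun b _ => hv b.src) h340J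
  exact ofBackground_mem_space'_lemma4_of_jInputs 𝓜 c hR hB hY hα₁ hL10 hξ hξ1 hcB hL hLξ hη.le hj hscale hξx hτ0 hτ1 hn hB'' hres''
    hresJ heGc π hπ hgc hπR hCπ hπn hXb hXd hX₂b hX₂p hXp hKgc hAgc h41 hH hHd h45 hK hKd h45τ hA hAd h42 hS hSτ hA2 huj hubar h338
    hJn h338₁ hJn₁


/-! ## v1.1 (3.36): the case `B′ = 0`; non-vacuity of the restriction list -/

/-- **(3.36) — Lemma 4 at `B′ = 0`, assembled end to end** («We have to prove that (U_j(□₀, exp iτB), J_j(□₀, exp iτB))|_X ∈ U^c_j(X, α₀, α₁)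
(3.36) for all 𝐔, 𝐉, 𝐀 in the above spaces, and for the parameters τ in the interval [0, 1]», p. 277): `ofBackground_mem_space'_lemma4_of_upper_space`
at `𝐀₂ = 0` — no (3.50)/(J3) input, no `α₃`-restriction used beyond the typed list. [cite: Balaban1987RG1, (3.36) p.277] -/
theorem ofBackground_mem_space'_eq336_of_upper_space (c : B12Sec2to5.Lemma4Consts) (hR : B12Sec2to5.Lemma4Restrictions c)
    (hB : 1 ≤ c.B₃) (hY : 1 ≤ c.B₃ ^ 2 * c.O₁ * c.M) (hα₁ : 16 * (c.O₁ * c.M * c.α₁) ≤ c.β) (hL10 : 1 + 10 * c.β ≤ c.L ^ 2)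
    {F : Frame P i 𝔸} {cs : StepConsts} (hξ : 0 < cs.ξ) (hξ1 : cs.ξ ≤ 1) (hcB : 0 < cs.cB)
    (hL : 1 ≤ cs.L) (hLξ : cs.L ^ cs.j * cs.ξ = 1)
    {η τ Cπ : ℝ} {j : ℕ} (hη : 0 < η) (hj : 1 ≤ j) (hscale : c.L ^ j * η ≤ 1)
    (hξx : cs.ξ * (c.L ^ (j - 1) * η) = c.L⁻¹ * η) (hτ0 : 0 ≤ τ) (hτ1 : τ ≤ 1)
    (hresJ : 4 * ((P.d - 1) * (Cπ * C311 1)) * (c.B₃ ^ 2 * c.O₁ * c.M) ^ 2 * c.α₀ ≤ c.β)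
    (heGc : ∀ A ∈ 𝓜.gc, expI cs.ξ A ∈ 𝓜.Gc) (π : 𝔸 →ₗ[ℂ] 𝔸) (hπ : ∀ X, π X ∈ 𝓜.gc)
    (hgc : ∀ g ∈ 𝓜.Gc, ∀ X ∈ 𝓜.gc, R g X ∈ 𝓜.gc) (hπR : ∀ (g : 𝔸ˣ) (X : 𝔸), π (R g X) = R g (π X))
    (hCπ : 0 ≤ Cπ) (hπn : ∀ X, ‖π X‖ ≤ Cπ * ‖X‖)
    {F' : Frame P i 𝔸} {cs' : StepConsts} (hj' : 1 ≤ cs'.j) (hLξ' : cs'.L ^ cs'.j * cs'.ξ = 1) (hξ' : cs'.ξ = c.L⁻¹ * η)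
    {a₁ γ₀' : ℝ} {Φ : FieldPair P i 𝔸ˣ 𝔸} (hΦ : Satisfies 𝓜 F' cs' ((1 + 2 * c.β) * c.α₀) a₁ γ₀' Φ)
    {Y : Region P i} (hXb : F.X.bonds ⊆ Y.bonds) (hXd : F.X.dpairs ⊆ Y.dpairs) (hX₂b : F.X₂.bonds ⊆ Y.bonds)
    (hX₂p : F.X₂.plaqs ⊆ F.X.plaqs) (hXp' : F.X.plaqs ⊆ F'.X₂.plaqs) (hYb' : Y.bonds ⊆ F'.X₂.bonds)
    (hXp : ∀ p ∈ F.X.plaqs, (⟨p.src, p.μ⟩ : PBond P i) ∈ Y.bonds ∧ (⟨p.src.shift p.μ, p.ν⟩ : PBond P i) ∈ Y.bonds ∧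
      (⟨p.src.shift p.ν, p.μ⟩ : PBond P i) ∈ Y.bonds ∧ (⟨p.src, p.ν⟩ : PBond P i) ∈ Y.bonds ∧
      (p.src, p.μ, p.ν) ∈ Y.dpairs ∧ (p.src, p.ν, p.μ) ∈ Y.dpairs)
    {H H₁ K : PBond P i → 𝔸} {ℓ : Plaq P i → 𝔸} (hKgc : ∀ b, K b ∈ 𝓜.gc)
    {uj ubar1 vj v : Site P i → 𝔸ˣ} {ubar w₁ : ℕ → Site P i → 𝔸ˣ} {ctr : ℕ → Site P i → Site P i}
    (huj : ∀ y, ‖(uj y : 𝔸)‖ * ‖(↑(uj y)⁻¹ : 𝔸)‖ ≤ Real.exp (c.B₃ ^ 2 * c.O₁ * c.M * c.α₀))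
    (hubar1 : ∀ y, ‖(ubar1 y : 𝔸)‖ * ‖(↑(ubar1 y)⁻¹ : 𝔸)‖ ≤ Real.exp (c.B₃ * c.O₁ * c.M * c.α₀))
    (hvj : ∀ y, ‖(vj y : 𝔸)‖ * ‖(↑(vj y)⁻¹ : 𝔸)‖ ≤ Real.exp (c.B₃ * c.O₁ * c.M * c.α₀))
    (hv : ∀ y, ‖(v y : 𝔸)‖ * ‖(↑(v y)⁻¹ : 𝔸)‖ ≤ Real.exp (c.O₁ * c.M * c.α₁))
    (hubar : ∀ n x, ubar n x = uj (ctr n x))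
    (h339 : ∀ p ∈ F.X.plaqs,
      plaq (fun b => expI cs.ξ (H b)) p = plaq (gaugeU (v * ubar1 * vj * uj)⁻¹ (F'.bg.Un cs'.j Φ.U)) p)
    (h342 : ∀ b ∈ Y.bonds, current π cs.ξ (fun b => expI cs.ξ (H b)) b =
      ((((v * ubar1 * vj * uj)⁻¹ : Site P i → 𝔸ˣ) b.src : 𝔸ˣ) : 𝔸) *
        ((((c.L ^ (j - 1) * η : ℝ) : ℂ) ^ 3) • F'.bg.Jn cs'.j Φ.U b) * ↑((((v * ubar1 * vj * uj)⁻¹ : Site P i → 𝔸ˣ) b.src)⁻¹ : 𝔸ˣ))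
    (h338 : ∀ m, 1 ≤ m → m ≤ cs.j → ∀ p ∈ F.X₂.plaqs, plaq (F.bg.Un m (fun b => expI cs.ξ (K b))) p =
      plaq (gaugeU (uj * (ubar m)⁻¹) (fun b => expI cs.ξ (K b))) p)
    (hJn : ∀ m, 1 ≤ m → m ≤ cs.j → ∀ b ∈ F.X₂.bonds, F.bg.Jn m (fun b => expI cs.ξ (K b)) b =
      current π (cs.L ^ m)⁻¹ (gaugeU (uj * (ubar m)⁻¹) (fun b => expI cs.ξ (K b))) b)
    (h338₁ : ∀ m, 1 ≤ m → m ≤ cs.j → ∀ p ∈ F.X₂.plaqs,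
      plaq (F.bg.Un m (1 : PBond P i → 𝔸ˣ)) p = plaq (gaugeU (w₁ m) (1 : PBond P i → 𝔸ˣ)) p)
    (hJn₁ : ∀ m, 1 ≤ m → m ≤ cs.j → ∀ b ∈ F.X₂.bonds,
      F.bg.Jn m (1 : PBond P i → 𝔸ˣ) b = current π (cs.L ^ m)⁻¹ (gaugeU (w₁ m) (1 : PBond P i → 𝔸ˣ)) b)
    (hH : ∀ b, ‖H b‖ < c.B₃ ^ 2 * c.O₁ * c.M * c.α₀ * (c.L ^ (j - 1) * η))
    (hHd : ∀ μ ν y, ‖grad cs.ξ μ (fun z => H ⟨z, ν⟩) y‖ < c.B₃ ^ 2 * c.O₁ * c.M * c.α₀ * (c.L ^ (j - 1) * η))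
    (h45 : ∀ p ∈ F.X.plaqs, ‖(cs.ξ : ℂ)⁻¹ • (H ⟨p.src, p.μ⟩ + H ⟨p.src.shift p.μ, p.ν⟩ - H ⟨p.src.shift p.ν, p.μ⟩ -
      H ⟨p.src, p.ν⟩) - ℓ p‖ < c.B₃ * (c.B₃ * c.O₁ * c.M * c.α₀ * (c.L ^ (j - 1) * η)) ^ 2)
    (hK : ∀ b, ‖K b‖ < c.B₃ ^ 2 * c.O₁ * c.M * c.α₀ * (c.L ^ (j - 1) * η))
    (hKd : ∀ μ ν y, ‖grad cs.ξ μ (fun z => K ⟨z, ν⟩) y‖ < c.B₃ ^ 2 * c.O₁ * c.M * c.α₀ * (c.L ^ (j - 1) * η))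
    (h45τ : ∀ p ∈ F.X.plaqs, ‖(cs.ξ : ℂ)⁻¹ • (K ⟨p.src, p.μ⟩ + K ⟨p.src.shift p.μ, p.ν⟩ - K ⟨p.src.shift p.ν, p.μ⟩ -
      K ⟨p.src, p.ν⟩) - (τ : ℂ) • ℓ p‖ < c.B₃ * (c.B₃ * c.O₁ * c.M * c.α₀ * (c.L ^ (j - 1) * η)) ^ 2)
    (hS : ∀ b ∈ Y.bonds, ‖lapCur π cs.ξ (1 : PBond P i → 𝔸ˣ) (H - H₁) b‖ < c.β * c.α₀ * (c.L ^ (j - 1) * η) ^ 2)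
    (hSτ : ∀ b ∈ Y.bonds,
      ‖lapCur π cs.ξ (1 : PBond P i → 𝔸ˣ) (K - (τ : ℂ) • H₁) b‖ < c.β * c.α₀ * (c.L ^ (j - 1) * η) ^ 2) :
    ofBackground π cs.ξ (fun b => expI cs.ξ (K b)) ∈ space' 𝓜 F cs c.α₀ c.α₁ := by
  have hR' := hR
  unfold B12Sec2to5.Lemma4Restrictions at hR'
  obtain ⟨hα₀, _, _, hα₃, hβ, _, _, _, _, _, _, _, _, _⟩ := hR'
  have hres'' : (0 : ℝ) * c.α₃ ≤ c.β * c.L⁻¹ ^ 2 * c.α₀ := by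
    rw [zero_mul]; exact mul_nonneg (mul_nonneg hβ.le (sq_nonneg _)) hα₀.le
  have hA : ∀ b : PBond P i, ‖(0 : PBond P i → 𝔸) b‖ ≤ c.B₃ * 0 := fun b => by simp
  have hAd : ∀ (μ ν : Fin P.d) (y : Site P i), ‖grad cs.ξ μ (fun z => (0 : PBond P i → 𝔸) ⟨z, ν⟩) y‖ ≤ c.B₃ * 0 :=
    fun μ ν y => by simp [grad]
  have hA2 : ∀ b ∈ Y.bonds, ‖lapCur π cs.ξ (1 : PBond P i → 𝔸ˣ) (0 : PBond P i → 𝔸) b‖ ≤ (0 : ℝ) * 0 := fun b _ => by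
    have h0 := B12Eq311RemainderQuadratic.lapCur_smul π cs.ξ (1 : PBond P i → 𝔸ˣ) (0 : ℂ) (0 : PBond P i → 𝔸) b
    rw [zero_smul, zero_smul] at h0
    rw [h0, norm_zero, zero_mul]
  have h := ofBackground_mem_space'_lemma4_of_upper_space 𝓜 c hR hB hY hα₁ hL10 hξ hξ1 hcB hL hLξ (A := 0) (n := 0) (B₃'' := 0)
    hη hj hscale hξx hτ0 hτ1 hα₃ le_rfl hres'' hresJ heGc π hπ hgc hπR hCπ hπn hj' hLξ' hξ' hΦ hXb hXd hX₂b hX₂p hXp' hYb' hXp hKgc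
    (fun _ => Submodule.zero_mem _) huj hubar1 hvj hv hubar h339 h342
    (fun m hm hm' p hp => by simpa only [Pi.zero_apply, add_zero] using h338 m hm hm' p hp)
    (fun m hm hm' b hb => by simpa only [Pi.zero_apply, add_zero] using hJn m hm hm' b hb) h338₁ hJn₁
    hH hHd h45 hK hKd h45τ hA hAd hS hSτ hA2
  simpa only [Pi.zero_apply, add_zero] using h

omit [NormedRing 𝔸] [NormedAlgebra ℂ 𝔸] [CompleteSpace 𝔸] [NormOneClass 𝔸] in
/-- **The restriction list of the assembled Lemma 4 is consistent** («for α₀, α₁, α₂, α₃ sufficiently small and satisfying all the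
restrictions»): for every `D ≥ 0` (the coefficient `(d − 1)·Cπ·C_F(1)` of `hresJ`) there are constants satisfying `Lemma4Restrictions` and ALL
the extra hypotheses of `ofBackground_mem_space'_lemma4_of_upper_space` (`hB`, `hY`, `hα₁`, `hL10`, `hres″` with `B₃″ = 1`, `hresJ`) —
e.g. `B₃ = O(1) = M = 1`, `L = 13`, `β = ½`, `β₀ = ¾`, `α₁ = 1/32`, `α₂ = 1`, `α₀ = 1/(2(4D + 64))`, `α₃ = α₀/1352`.
[cite: Balaban1987RG1, Lemma 4 p.280] -/
theorem restrictions_nonvacuous {D : ℝ} (hD : 0 ≤ D) :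
    ∃ c : B12Sec2to5.Lemma4Consts, B12Sec2to5.Lemma4Restrictions c ∧ 1 ≤ c.B₃ ∧ 1 ≤ c.B₃ ^ 2 * c.O₁ * c.M ∧
      16 * (c.O₁ * c.M * c.α₁) ≤ c.β ∧ 1 + 10 * c.β ≤ c.L ^ 2 ∧ 1 * c.α₃ ≤ c.β * c.L⁻¹ ^ 2 * c.α₀ ∧
      4 * D * (c.B₃ ^ 2 * c.O₁ * c.M) ^ 2 * c.α₀ ≤ c.β := by
  have hT : 0 < 2 * (4 * D + 64) := by positivity
  refine ⟨⟨1, 1, 1, 13, 3 / 4, 1 / 2, 1 / (2 * (4 * D + 64)), 1 / 32, 1, 1 / (2 * (4 * D + 64)) / 1352⟩, ?_, le_rfl, by norm_num,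
    by norm_num, by norm_num, ?_, ?_⟩
  · unfold B12Sec2to5.Lemma4Restrictions
    have hα₀ : 0 < 1 / (2 * (4 * D + 64)) := by positivity
    have hα₀' : 1 / (2 * (4 * D + 64)) ≤ 1 / 128 :=
      one_div_le_one_div_of_le (by norm_num) (by nlinarith)
    refine ⟨hα₀, by norm_num, by norm_num, by positivity, by norm_num, by norm_num, by norm_num, by norm_num, ?_, ?_, by norm_num,
      ?_, ?_, by norm_num⟩
    · dsimp only; nlinarith
    · dsimp only; nlinarith
    · dsimp only; nlinarith
    · dsimp only
      have : (13 : ℝ)⁻¹ ^ 2 = 1 / 169 := by norm_num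
      rw [this]
      have h0 := hα₀.le
      nlinarith
  · dsimp only
    have : (13 : ℝ)⁻¹ ^ 2 = 1 / 169 := by norm_num
    rw [this]
    have h0 : 0 ≤ 1 / (2 * (4 * D + 64)) := by positivity
    nlinarith
  · dsimp only
    rw [show 4 * D * (1 ^ 2 * 1 * 1 : ℝ) ^ 2 * (1 / (2 * (4 * D + 64))) = 4 * D / (2 * (4 * D + 64)) by ring,
      div_le_iff₀ hT]
    nlinarith

end Literature.MathematicalPhysics.QuantumFieldTheory.Balaban1983to89.B12Lemma4Assembled
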